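import Summits.ResolutionOfSingularities.ResolutionOfSingularities.Theorems.WeightedInvariantIota3NonreachKTools
import Summits.ResolutionOfSingularities.ResolutionOfSingularities.Theorems.WeightedInvariantIsolatedCoefficient
import HarnessLib

/-!
# (NONREACH-K) in the coordinates of the pinned successor, UNIFORMLY in the translate: the line-top witness
# (door `HypersurfaceCentreConstruction`, stmt-ResolutionOfSingularities-19897, stub `stub_keyRungGrHomLE_three`)

Helper for `stub_keyRungGrHomLE_three` (def-free, `--supports 19897`).  Hand -10's residual (NONREACH-K) of the gap list of record
`keyRungGrHomLE_three_of_tieDescent_point_nonreachK` (…KeyRungThreeOfDropCurveNonreachK; SIGMA-ISO.md rev 3 §2) asks, at the regular local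
threefold `L = B_𝔫` with regular parameters `(T, z, W)` (`T = t⁻¹`), that the saturated transform `g` reaches the slope `(q+ρ)/q` along NO
translate `W − c'·T`.  This file proves it in `L`-coordinates from a unit expansion of `g`, UNIFORMLY in `c'` (no residue-field structure of
`κ(𝔫)`, no split into the straight member and the unit translates):

* §2 arithmetic **`Iota3.low_of_face_of_witness`**: FACE `ρν ≤ qe₀ + ρe₂` and WITNESS `qe₀ + e₁ + (ρ+1)e₂ < (ρ+1)ν` give LOW
  `qe₀ + qe₁ + (q+ρ)e₂ < (q+ρ)ν` (`ρ < q`; R9's «witness lands low» in `(T, z, W)`-exponents).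
* §3 **`Iota3.not_mem_ratContactFiltration_translate_of_expansion`**: `L` regular local of dimension `3`, `(T, z, W) = 𝔪`, `ρ < q`,
  `(q+ρ)ν ≤ N`, `g ≡ Σ_{α ∈ Δ} a_α T^{α₀} z^{α₁} W^{α₂} (mod 𝔪^N)` with UNIT coefficients, every exponent of `Δ` on the AQS FACE and one
  WITNESS exponent ⟹ `∀ c', g ∉ ratContactFiltration (W − c'T) (q+ρ) q ((q+ρ)ν)`.  Proof: substitute `W = c'T + W'`; among the substituted
  exponents satisfying WITNESS pick `α₀` minimising `2e₀ + e₁ + e₂`: it is hit by exactly one term (coefficient `a_{α₀}`, a unit), it is isolated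
  from below, and it is LOW; the isolated-coefficient lemma (…IsolatedCoefficient) in the frame `(T, z, W')`
  (`weightedMonomialIdeal_eq_ratContactFiltration`) makes that coefficient a non-unit.

What remains for (NONREACH-K) in the door's binders (SIGMA-ISO.md §2): a unit expansion of `f` in `S` supported on the AQS face
(`mem_weightedMonomialIdeal_of_curve_lexMax` + peeling inside the face), the witness (`not_mem_tie_of_curve_lexMax`, `λ = 0`), and their
transport along `x = T·X` (`X` a unit at `𝔫`), `y = T^b·W` to the hypotheses FACE / WITNESS of §3 (exponent map `(j,i,k) ↦ (j + bi − bν, k, i)`).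

[OURS · L1 W4.3 · kernel lemmas; AI work, weaker than expert review; nothing here is a statement of the manuscript under review
(Hironaka 2017, [claim: Hironaka2017, status: under-review]).]

## References

* H. Matsumura, *Commutative Ring Theory*, CUP 1987, Thm 16.2. [Matsumura1987]
* H. Hironaka, *Characteristic polyhedra of singularities*, J. Math. Kyoto Univ. 7 (1967), §3. [Hironaka1967]
* res-L1-w43-idea-2, Sketch-R9 §5 («the witness lands low»; OURS); hand -10, SIGMA-ISO.md rev 3 (crux directory; OURS).
-/

noncomputable section

set_option linter.dupNamespace false -- mandated namespace of this single-conjunct summit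

open IsLocalRing Literature.AlgebraicGeometry.Resolution

/-! ## §2 The arithmetic: FACE + WITNESS ⇒ LOW, and the selection functional -/

namespace Summit.ResolutionOfSingularities.ResolutionOfSingularities.Cruxes.HypersurfaceCentreConstruction.LocalEngine

namespace Iota3

open Summit.ResolutionOfSingularities.ResolutionOfSingularities.Theorems
open Summit.ResolutionOfSingularities.ResolutionOfSingularities.Cruxes.HypersurfaceCentreConstruction.LocalEngine.Iota3.RatContact

/-- **FACE + WITNESS ⇒ LOW** in the coordinates `(T, z, W)` of the pinned successor (`e = (e₀, e₁, e₂)` the exponent of `T^{e₀} z^{e₁} W^{e₂}`,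
`ρ < q`): the AQS face condition `ρν ≤ q e₀ + ρ e₂` and the `τ = 0` witness inequality `q e₀ + e₁ + (ρ+1) e₂ < (ρ+1)ν` give
`q e₀ + q e₁ + (q+ρ) e₂ < (q+ρ)ν` («the witness lands low», R9 §5). [OURS · L1 W4.3] -/
theorem low_of_face_of_witness {q ρ ν e₀ e₁ e₂ : ℕ} (hρq : ρ < q) (hface : ρ * ν ≤ q * e₀ + ρ * e₂)
    (hwit : q * e₀ + e₁ + (ρ + 1) * e₂ < (ρ + 1) * ν) : q * e₀ + q * e₁ + (q + ρ) * e₂ < (q + ρ) * ν := by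
  have he₂ : e₂ < ν := by
    by_contra h
    have h' : ν ≤ e₂ := Nat.le_of_not_lt h
    have := Nat.mul_le_mul_left (ρ + 1) h'
    omega
  obtain ⟨m, rfl⟩ : ∃ m, ν = e₂ + m := ⟨ν - e₂, by omega⟩
  have hm : 1 ≤ m := by omega
  have hface' : ρ * m ≤ q * e₀ := by nlinarith [hface]
  have hwit' : q * e₀ + e₁ < (ρ + 1) * m := by nlinarith [hwit]
  have he₁ : e₁ + 1 ≤ m := by nlinarith [hface', hwit']
  have hq1 : 1 ≤ q := by omega
  have key : q * e₀ + q * e₁ < (q + ρ) * m := by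
    have h1 : q * e₁ = e₁ + (q - 1) * e₁ := by
      obtain ⟨q', rfl⟩ : ∃ q', q = q' + 1 := ⟨q - 1, by omega⟩
      simp; ring
    have h2 : (q - 1) * e₁ ≤ (q - 1) * (m - 1) := Nat.mul_le_mul_left _ (by omega)
    have h3 : (q - 1) * (m - 1) + (ρ + 1) * m = (q + ρ) * m - q + 1 := by
      obtain ⟨q', rfl⟩ : ∃ q', q = q' + 1 := ⟨q - 1, by omega⟩
      obtain ⟨m', rfl⟩ : ∃ m', m = m' + 1 := ⟨m - 1, by omega⟩
      simp only [Nat.add_sub_cancel]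
      ring_nf
      omega
    have h4 : q ≤ (q + ρ) * m := by nlinarith
    omega
  nlinarith [key]

/-! ## §3 (NONREACH-K) in `L`-coordinates, uniformly in the translate -/

/-- `span {T, z, W − c'T} = span {T, z, W}`. [folklore] -/
theorem span_triple_translate_eq {L : Type} [CommRing L] (T z W c' : L) :
    Ideal.span ({T, z, W - c' * T} : Set L) = Ideal.span {T, z, W} := by
  apply le_antisymm
  · rw [Ideal.span_le]
    intro x hx
    simp only [Set.mem_insert_iff, Set.mem_singleton_iff] at hx
    rcases hx with rfl | rfl | rfl
    · exact Ideal.subset_span (by simp)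
    · exact Ideal.subset_span (by simp)
    · exact Ideal.sub_mem _ (Ideal.subset_span (by simp)) (Ideal.mul_mem_left _ _ (Ideal.subset_span (by simp)))
  · rw [Ideal.span_le]
    intro x hx
    simp only [Set.mem_insert_iff, Set.mem_singleton_iff] at hx
    rcases hx with rfl | rfl | rfl
    · exact Ideal.subset_span (by simp)
    · exact Ideal.subset_span (by simp)
    · have h : x = (x - c' * T) + c' * T := by ring
      rw [h]
      exact Ideal.add_mem _ (Ideal.subset_span (by simp)) (Ideal.mul_mem_left _ _ (Ideal.subset_span (by simp)))

/-- **(NONREACH-K) in the coordinates of the pinned successor, uniformly in the translate.**  `L` regular local of Krull dimension `3`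
with regular parameters `(T, z, W)`; `ρ < q`, `(q+ρ)ν ≤ N`; `g ≡ Σ_{α ∈ Δ} a_α T^{α₀} z^{α₁} W^{α₂} (mod 𝔪^N)` with UNIT coefficients;
every exponent of `Δ` satisfies the AQS FACE condition `ρν ≤ q α₀ + ρ α₂`, and some exponent of `Δ` is a `τ = 0` WITNESS
`q α₀ + α₁ + (ρ+1) α₂ < (ρ+1)ν`.  Then for EVERY `c' ∈ L`: `g ∉ ratContactFiltration (W − c'T) (q+ρ) q ((q+ρ)ν)` — the transform reaches
the slope `(q+ρ)/q` along no translate of `W` by `T`.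

Proof.  Put `W' = W − c'T` and expand `W^{α₂} = (c'T + W')^{α₂}`: `g ≡ Σ_{β ∈ Δ, l ≤ β₂} a_β c'^l C(β₂,l) · T^{β₀+l} z^{β₁} W'^{β₂−l}`, an
expansion in the regular parameters `(T, z, W')` with arbitrary coefficients.  Among its exponents satisfying the WITNESS inequality
(non-empty: the witness of `Δ` with `l = 0`) choose `α₀` minimising `Φ = 2e₀ + e₁ + e₂`.  (i) `α₀` is hit only by `(β, l) = (α₀, 0)`: a hit
with `l ≥ 1` would put `(α₀₀ − 1, α₀₁, α₀₂ + 1)` (same `β`, `l − 1`) among the witnesses (`ρ + 1 ≤ q`) with smaller `Φ`; so `α₀ ∈ Δ` and its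
coefficient is the unit `a_{α₀}`.  (ii) `α₀` is isolated from below: an exponent `e ≤ α₀` of the expansion is a witness (monotonicity), so
`Φ(α₀) ≤ Φ(e) ≤ Φ(α₀)` forces `e = α₀`.  (iii) `α₀` is LOW (`low_of_face_of_witness`; the face condition passes from `Δ` to `α₀ ∈ Δ`).  By
`weightedMonomialIdeal_eq_ratContactFiltration` the filtration is `𝒥((T, z, W'); (q, q, q+ρ))`, and the isolated-coefficient lemma (§1) at the
layer of `α₀` (`< (q+ρ)ν ≤ N`) makes `a_{α₀}` a non-unit: contradiction. [OURS · L1 W4.3] [cite: Matsumura1987, Thm. 16.2] -/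
theorem not_mem_ratContactFiltration_translate_of_expansion {L : Type} [CommRing L] [IsRegularLocalRing L]
    (hdim : ringKrullDim L = (3 : ℕ)) {T z W : L} (h𝔪 : Ideal.span {T, z, W} = maximalIdeal L)
    {q ρ ν N : ℕ} (hρq : ρ < q) (hN : (q + ρ) * ν ≤ N)
    {Δ : Finset (Fin 3 → ℕ)} {a : (Fin 3 → ℕ) → L} (hunit : ∀ α ∈ Δ, IsUnit (a α))
    {g : L} (hr : g - ∑ α ∈ Δ, a α * ∏ i, ![T, z, W] i ^ α i ∈ maximalIdeal L ^ N)
    (hface : ∀ α ∈ Δ, ρ * ν ≤ q * α 0 + ρ * α 2)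
    (hwit : ∃ α ∈ Δ, q * α 0 + α 1 + (ρ + 1) * α 2 < (ρ + 1) * ν) (c' : L) :
    g ∉ ratContactFiltration (W - c' * T) (q + ρ) q ((q + ρ) * ν) := by
  classical
  intro hmem
  have hq : 0 < q := by omega
  -- the translated frame
  set W' : L := W - c' * T with hW'def
  have hWeq : W = c' * T + W' := by rw [hW'def]; ring
  have h𝔪' : Ideal.span ({T, z, W'} : Set L) = maximalIdeal L := by rw [hW'def, span_triple_translate_eq]; exact h𝔪
  set u' : Fin 3 → L := ![T, z, W'] with hu'def
  have hu' : Ideal.span (Set.range u') = maximalIdeal L := by rw [hu'def, range_three]; exact h𝔪'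
  set wt : Fin 3 → ℕ := ![q, q, q + ρ] with hwtdef
  have hwt : ∀ i, 0 < wt i := by intro i; fin_cases i <;> simp [hwtdef, hq]
  have hwt_apply : ∀ e : Fin 3 → ℕ, ∑ i, wt i * e i = q * e 0 + q * e 1 + (q + ρ) * e 2 := fun e => by
    simp only [hwtdef, Fin.sum_univ_three, Matrix.cons_val_zero, Matrix.cons_val_one, Matrix.cons_val_two, Matrix.tail_cons,
      Matrix.head_cons]
  have hmon : ∀ e : Fin 3 → ℕ, ∏ i, u' i ^ e i = T ^ e 0 * z ^ e 1 * W' ^ e 2 := fun e => by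
    simp only [hu'def, Fin.prod_univ_three, Matrix.cons_val_zero, Matrix.cons_val_one, Matrix.cons_val_two, Matrix.tail_cons,
      Matrix.head_cons]
  -- membership in the weighted ideal of the translated frame
  rw [← weightedMonomialIdeal_eq_ratContactFiltration h𝔪' hq (by omega)] at hmem
  -- the substituted expansion, as a finsupp on exponents
  set E : (Fin 3 → ℕ) → ℕ → (Fin 3 → ℕ) := fun β l => ![β 0 + l, β 1, β 2 - l] with hEdef
  have hE0 : ∀ β l, E β l 0 = β 0 + l := fun β l => by simp [hEdef]
  have hE1 : ∀ β l, E β l 1 = β 1 := fun β l => by simp [hEdef]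
  have hE2 : ∀ β l, E β l 2 = β 2 - l := fun β l => by simp [hEdef]
  have hEzero : ∀ β, E β 0 = β := fun β => by
    funext i; fin_cases i
    · exact (hE0 β 0).trans (by simp)
    · exact hE1 β 0
    · exact (hE2 β 0).trans (by simp)
  set lsub : (Fin 3 → ℕ) →₀ L :=
    ∑ β ∈ Δ, ∑ l ∈ Finset.range (β 2 + 1), Finsupp.single (E β l) (a β * (c' ^ l * ((β 2).choose l : L))) with hlsub
  -- its value
  have hval : ∑ e ∈ lsub.support, lsub e * ∏ i, u' i ^ e i = ∑ α ∈ Δ, a α * ∏ i, ![T, z, W] i ^ α i := by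
    have h1 : ∑ e ∈ lsub.support, lsub e * ∏ i, u' i ^ e i = Finsupp.linearCombination L (fun e : Fin 3 → ℕ => ∏ i, u' i ^ e i) lsub := by
      rw [Finsupp.linearCombination_apply, Finsupp.sum]; rfl
    rw [h1, hlsub]
    simp only [map_sum, Finsupp.linearCombination_single, smul_eq_mul, hmon, hE0, hE1, hE2]
    refine Finset.sum_congr rfl fun β hβ => ?_
    have h2 : ∏ i, ![T, z, W] i ^ β i = T ^ β 0 * z ^ β 1 * W ^ β 2 := by
      simp only [Fin.prod_univ_three, Matrix.cons_val_zero, Matrix.cons_val_one, Matrix.cons_val_two, Matrix.tail_cons,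
        Matrix.head_cons]
    rw [h2, hWeq, add_pow, Finset.mul_sum, Finset.mul_sum]
    refine Finset.sum_congr rfl fun l hl => ?_
    rw [mul_pow, pow_add]
    ring
  have hr' : g - ∑ e ∈ lsub.support, lsub e * ∏ i, u' i ^ e i ∈ maximalIdeal L ^ N := by rw [hval]; exact hr
  -- support of the substituted expansion
  have hsupp : ∀ e ∈ lsub.support, ∃ β ∈ Δ, ∃ l, l ≤ β 2 ∧ e = E β l := by
    intro e he
    rw [hlsub] at he
    have h1 := Finsupp.support_finsetSum he
    rw [Finset.mem_biUnion] at h1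
    obtain ⟨β, hβ, h2⟩ := h1
    have h3 := Finsupp.support_finsetSum h2
    rw [Finset.mem_biUnion] at h3
    obtain ⟨l, hl, h4⟩ := h3
    have h5 := Finsupp.support_single_subset h4
    rw [Finset.mem_singleton] at h5
    exact ⟨β, hβ, l, by have := Finset.mem_range.mp hl; omega, h5⟩
  -- the witness part of the substituted support and the selection of `α₀`
  set Fall : Finset (Fin 3 → ℕ) := Δ.biUnion fun β => (Finset.range (β 2 + 1)).image (E β) with hFall
  have hFall_mem : ∀ β ∈ Δ, ∀ l, l ≤ β 2 → E β l ∈ Fall := fun β hβ l hl =>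
    Finset.mem_biUnion.mpr ⟨β, hβ, Finset.mem_image.mpr ⟨l, Finset.mem_range.mpr (by omega), rfl⟩⟩
  have hFall_spec : ∀ e ∈ Fall, ∃ β ∈ Δ, ∃ l, l ≤ β 2 ∧ e = E β l := fun e he => by
    obtain ⟨β, hβ, h⟩ := Finset.mem_biUnion.mp he
    obtain ⟨l, hl, rfl⟩ := Finset.mem_image.mp h
    exact ⟨β, hβ, l, by have := Finset.mem_range.mp hl; omega, rfl⟩
  set Fwit : Finset (Fin 3 → ℕ) := Fall.filter (fun e => q * e 0 + e 1 + (ρ + 1) * e 2 < (ρ + 1) * ν) with hFwit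
  have hne : Fwit.Nonempty := by
    obtain ⟨αw, hαw, hw⟩ := hwit
    exact ⟨αw, Finset.mem_filter.mpr ⟨by rw [← hEzero αw]; exact hFall_mem αw hαw 0 (Nat.zero_le _), hw⟩⟩
  obtain ⟨α₀, hα₀, hmin⟩ := Finset.exists_min_image Fwit (fun e => 2 * e 0 + e 1 + e 2) hne
  obtain ⟨hα₀all, hα₀wit⟩ := Finset.mem_filter.mp hα₀
  -- (i) `α₀` is hit only with `l = 0`
  have honly : ∀ β ∈ Δ, ∀ l, l ≤ β 2 → E β l = α₀ → l = 0 := by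
    intro β hβ l hl heq
    by_contra hl0
    have hl1 : 1 ≤ l := Nat.one_le_iff_ne_zero.mpr hl0
    have h0 : α₀ 0 = β 0 + l := by rw [← heq, hE0]
    have h1 : α₀ 1 = β 1 := by rw [← heq, hE1]
    have h2 : α₀ 2 = β 2 - l := by rw [← heq, hE2]
    have hmem' : E β (l - 1) ∈ Fwit := by
      refine Finset.mem_filter.mpr ⟨hFall_mem β hβ (l - 1) (by omega), ?_⟩
      rw [hE0, hE1, hE2]
      have e1 : q * (β 0 + (l - 1)) + q = q * α₀ 0 := by rw [h0]; zify [hl1]; ring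
      have e2 : (ρ + 1) * (β 2 - (l - 1)) = (ρ + 1) * α₀ 2 + (ρ + 1) := by rw [h2]; zify [hl, hl1, show l - 1 ≤ β 2 by omega]; ring
      nlinarith [hα₀wit, e1, e2, hρq]
    have hlt := hmin _ hmem'
    rw [hE0, hE1, hE2] at hlt
    omega
  have hα₀Δ : α₀ ∈ Δ := by
    obtain ⟨β, hβ, l, hl, heq⟩ := hFall_spec α₀ hα₀all
    have := honly β hβ l hl heq.symm
    subst this
    rw [heq, hEzero]; exact hβ
  -- (ii) `α₀` is isolated from below in the substituted support
  have hiso : ∀ e ∈ lsub.support, e ≤ α₀ → e = α₀ := by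
    intro e he hle
    obtain ⟨β, hβ, l, hl, rfl⟩ := hsupp e he
    have h0 : E β l 0 ≤ α₀ 0 := hle 0
    have h1 : E β l 1 ≤ α₀ 1 := hle 1
    have h2 : E β l 2 ≤ α₀ 2 := hle 2
    have hmem' : E β l ∈ Fwit := by
      refine Finset.mem_filter.mpr ⟨hFall_mem β hβ l hl, ?_⟩
      calc q * E β l 0 + E β l 1 + (ρ + 1) * E β l 2 ≤ q * α₀ 0 + α₀ 1 + (ρ + 1) * α₀ 2 := by
            gcongr
        _ < (ρ + 1) * ν := hα₀wit
    have hΦ := hmin _ hmem'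
    have h0' : E β l 0 = α₀ 0 := by omega
    have h1' : E β l 1 = α₀ 1 := by omega
    have h2' : E β l 2 = α₀ 2 := by omega
    funext i; fin_cases i
    · exact h0'
    · exact h1'
    · exact h2'
  -- the coefficient at `α₀` is the unit `a α₀`
  have hcoeff : lsub α₀ = a α₀ := by
    rw [hlsub, Finsupp.finsetSum_apply, Finset.sum_eq_single α₀]
    · rw [Finsupp.finsetSum_apply, Finset.sum_eq_single 0]
      · rw [hEzero, Finsupp.single_eq_same, pow_zero, Nat.choose_zero_right, Nat.cast_one, mul_one, mul_one]
      · intro l hl hl0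
        rw [Finsupp.single_apply, if_neg]
        exact fun h => hl0 (honly α₀ hα₀Δ l (by have := Finset.mem_range.mp hl; omega) h)
      · intro h; exact absurd (Finset.mem_range.mpr (Nat.succ_pos _)) h
    · intro β hβ hne'
      rw [Finsupp.finsetSum_apply]
      refine Finset.sum_eq_zero fun l hl => ?_
      rw [Finsupp.single_apply, if_neg]
      intro h
      have hl' : l ≤ β 2 := by have := Finset.mem_range.mp hl; omega
      have := honly β hβ l hl' h
      subst this
      rw [hEzero] at h
      exact hne' h
    · intro h; exact absurd hα₀Δ h
  -- (iii) `α₀` is low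
  have hlow : q * α₀ 0 + q * α₀ 1 + (q + ρ) * α₀ 2 < (q + ρ) * ν :=
    low_of_face_of_witness hρq (hface α₀ hα₀Δ) hα₀wit
  -- the isolated-coefficient lemma in the frame `(T, z, W')`
  have hk : ∑ i, wt i * α₀ i = q * α₀ 0 + q * α₀ 1 + (q + ρ) * α₀ 2 := hwt_apply α₀
  have hg : g ∈ weightedMonomialIdeal u' wt (q * α₀ 0 + q * α₀ 1 + (q + ρ) * α₀ 2 + 1) :=
    weightedMonomialIdeal_antitone u' wt (by omega) hmem
  have key := LocalGameEFTNewton.coeff_mem_maximalIdeal_of_isolated u' hu' hdim wt hwt (by omega) hg hk lsub hr' hiso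
  rw [hcoeff] at key
  exact (IsLocalRing.mem_maximalIdeal _).mp key (hunit α₀ hα₀Δ)

end Iota3

end Summit.ResolutionOfSingularities.ResolutionOfSingularities.Cruxes.HypersurfaceCentreConstruction.LocalEngine

end
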